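import Summits.QuantumFields.YangMills.Theorems.UnitScaleTiltProp7CombTildLinearResponse
import HarnessLib

/-!
# Route `UnitScaleTilt`, crux K1 «MinimiserStabilityRegPr» (stmt-QuantumFields-19200), route-R E′ (A′)-on-Σ, P-A2 (β), row `hMcomb₂` ⟸ H2-1 — file H-2
# «THE SECOND-ORDER DEFECT OF PRINT's SINGLE BARS OBEYS THE INHOMOGENEOUS LINEARISED CORNERED TOWER»:
# **`‖E_{l+1}(z, κ) − T_l(E_l)(L•z, κ)‖ ≤ 260·m²`**, `E_l := (Ũˡ[V] − 1) − Q l Y′` — ★routeR-w1 g9's MASTER memo §4 telescope `E_{j+1} = rem_j + T_j(E_j)` BY KERNEL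

Cell `ym3-torus` (HUMAN RULING D-0037: YM₃ on the torus is ladder rung R3 — not d = 4, not a mass gap, not Clay), width seat `ym3-torus-px17` (gen 4); ★★OWNER RULINGS №20 (1) (`hMcomb₂`),
№22 (c); ★routeR-w1 g9 07:08:36Z.  `--supports stmt-QuantumFields-19200 --as helper`; THEOREMS ONLY (0 `def`, 0 `sorry`); count-neutral.  «route-internal row (n3)-comb₂ — NOT N06,
NOT a print row; OPEN».  Nothing of `hMcomb`, `hMcomb₂`, H2-1, (β), `hPA2`, `hcoS`, E′, EX, the crux, d = 4 or the gap is claimed.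

THE POINT.  For ANY perturbation configuration `V` (print's comb tower `Ũˡ[V] = tildIter L U₀ V l`, [Balaban1985Averaging] (68)∕(69)) and ANY level-0 field `Y′` propagated by
★routeR-w1's linearised cornered tower `Q` (✓`Prop7CornerCombStructure.exists_linTower_family`, recursion text displayed VERBATIM), the second-order defect
`E_l := (Ũˡ[V] − 1) − Q l Y′` satisfies, at every coarse bond `(z, κ)` of level `l + 1`,
`E_{l+1}(z, κ) − T_l(E_l)(L•z, κ) = Ũˡ⁺¹[V](z, κ) − 1 − T_l(Ũˡ[V] − 1)(L•z, κ)` EXACTLY (additivity of the cornered one-step true derivative `T_l`, ✓`trueStep_add`, and the recursion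
text `Q (l+1) Y′ (z,κ) = T_l(Q l Y′)(L•z, κ)`), and the right side is F-2b's one-step remainder, `≤ 260·m²` under F-2b's displayed hypotheses (✓`Prop7CombTildTrueLin.
norm_tildIter_succ_sub_one_sub_trueLin_le`: `Ū₀ˡ` unitary-valued with block loops `α ≤ 1∕24`, `Ũˡ[V]` in `U1`, walk masses of `Ũˡ[V] − 1` along the block loops and the segment
`≤ m ≤ 1∕72`).  With H-1 (✓`Prop7CombTildLinearResponse.fderiv_coe_tildIter_eq_linTower`) `Q l Y′` IS the Fréchet derivative of the tower along any differentiable family with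
velocity `Y′`, so `E_l` IS px13's SIGNATURE-0′ summand vector; `E_0 = V − 1 − Y′` (for `V = (e^{A})♯`, `Y′ = A♯`: `e^{A} − 1 − A` bondwise).  The `ℓ¹` propagation of the sources
`rem_j` through `T_{l−1} ∘ ⋯ ∘ T_{j+1}` (MASTER §4's H2-1) is the OPEN analytic row and is NOT touched here.

WHAT IS PROVED (ns `…Theorems.Prop7CombTildRem2Recursion`; `𝔸` any (nontrivial) C⋆-algebra; every `d`, `L`, `U₀`, `V`, `Y′`).
* §1 `trueStep_sub` (the written-out one-step operator is subtractive), `rem2_zero` (`E_0 = V − 1 − Y′` under `Q 0 Y′ = Y′`, lit `tildIter_zero'`).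
* §2 ★★★ `rem2_succ_sub_trueStep_eq` (the exact identity) and ★★★ `norm_rem2_succ_sub_trueStep_le` (`≤ 260·m²`).
HONEST SCOPE.  One identity and one `exact` over F-2b; every analytic hypothesis displayed; no member, no currency (file H-3).  Rung R3, not Clay; YM gap NOT proved.

References: T. Bałaban, CMP **98** (1985) 17–51 [Balaban1985Averaging] ((42)–(43) pp.23–24, (65)∕(68)∕(69) p.29, Prop. 3 (113)–(124) pp.34–36); CMP **109** (1987) 249–301
[Balaban1987RG1] ((0.4) p.253).
-/

set_option autoImplicit false

noncomputable section

open scoped BigOperators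

namespace Summit.QuantumFields.YangMills.Theorems.Prop7CombTildRem2Recursion

open NormedSpace
open Literature.MathematicalPhysics.QuantumFieldTheory.Balaban1983to89
open ExpMeanLog (eml)
open B7Prop1Explicit (Site Letter hol seg boxVec gammaWord Wcx Xavg expUnit stepA U1)
open B7Prop2Explicit (avgIter unitaryUnits)
open B7Eq92Concrete (tildIter tildIter_zero')
open B7Prop3GeneralRotated (tsum)
open Summit.QuantumFields.YangMills.Theorems.Prop7CombTildTrueLin (norm_tildIter_succ_sub_one_sub_trueLin_le)
open Summit.QuantumFields.YangMills.Theorems.Prop7CornerCombStructure (trueStep_add)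

variable {d : ℕ} {𝔸 : Type*} [CStarAlgebra 𝔸]

/-! ## §1 Letters -/

/-- **The cornered one-step true derivative (written out) is subtractive in the field** (from ✓`trueStep_add`). [cite: Balaban1985Averaging, (119)-(122) pp.35-36] -/
theorem trueStep_sub (L : ℕ) (V₀ : Site d → Fin d → 𝔸ˣ) (X X' : Site d → Fin d → 𝔸) (q : Site d) (κ : Fin d) :
    fderiv ℂ (eml : ((Fin d → Fin L) → 𝔸) → 𝔸) (fun r => ((Wcx L V₀ q κ (boxVec L r) : 𝔸ˣ) : 𝔸))
          (fun r => tsum V₀ (X - X') q (gammaWord L κ (boxVec L r) ++ seg κ (-(L : ℤ))) * ((Wcx L V₀ q κ (boxVec L r) : 𝔸ˣ) : 𝔸))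
          * (((expUnit (Xavg L V₀ q κ))⁻¹ : 𝔸ˣ) : 𝔸)
        + ((expUnit (Xavg L V₀ q κ) : 𝔸ˣ) : 𝔸) * tsum V₀ (X - X') q (seg κ (L : ℤ)) * (((expUnit (Xavg L V₀ q κ))⁻¹ : 𝔸ˣ) : 𝔸)
      = (fderiv ℂ (eml : ((Fin d → Fin L) → 𝔸) → 𝔸) (fun r => ((Wcx L V₀ q κ (boxVec L r) : 𝔸ˣ) : 𝔸))
            (fun r => tsum V₀ X q (gammaWord L κ (boxVec L r) ++ seg κ (-(L : ℤ))) * ((Wcx L V₀ q κ (boxVec L r) : 𝔸ˣ) : 𝔸))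
            * (((expUnit (Xavg L V₀ q κ))⁻¹ : 𝔸ˣ) : 𝔸)
          + ((expUnit (Xavg L V₀ q κ) : 𝔸ˣ) : 𝔸) * tsum V₀ X q (seg κ (L : ℤ)) * (((expUnit (Xavg L V₀ q κ))⁻¹ : 𝔸ˣ) : 𝔸))
        - (fderiv ℂ (eml : ((Fin d → Fin L) → 𝔸) → 𝔸) (fun r => ((Wcx L V₀ q κ (boxVec L r) : 𝔸ˣ) : 𝔸))
            (fun r => tsum V₀ X' q (gammaWord L κ (boxVec L r) ++ seg κ (-(L : ℤ))) * ((Wcx L V₀ q κ (boxVec L r) : 𝔸ˣ) : 𝔸))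
            * (((expUnit (Xavg L V₀ q κ))⁻¹ : 𝔸ˣ) : 𝔸)
          + ((expUnit (Xavg L V₀ q κ) : 𝔸ˣ) : 𝔸) * tsum V₀ X' q (seg κ (L : ℤ)) * (((expUnit (Xavg L V₀ q κ))⁻¹ : 𝔸ˣ) : 𝔸)) := by
  have h := trueStep_add L V₀ (X - X') X' q κ
  rw [sub_add_cancel] at h
  rw [h, add_sub_cancel_right]

/-- **Level 0 of the second-order defect**: `E_0 = V − 1 − Y′` (`Ũ⁰[V] = V`, lit ✓`tildIter_zero'`; `Q 0 Y′ = Y′`). [cite: Balaban1985Averaging, (69) p.29] -/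
theorem rem2_zero (L : ℕ) (U₀ V : Site d → Fin d → 𝔸ˣ) (Q : ℕ → (Site d → Fin d → 𝔸) → Site d → Fin d → 𝔸) (hQ0 : ∀ Y, Q 0 Y = Y)
    (Y' : Site d → Fin d → 𝔸) (x : Site d) (μ : Fin d) :
    ((tildIter L U₀ V 0 x μ : 𝔸ˣ) : 𝔸) - 1 - Q 0 Y' x μ = ((V x μ : 𝔸ˣ) : 𝔸) - 1 - Y' x μ := by
  rw [tildIter_zero', hQ0]

/-! ## §2 ★★★ The recursion of the second-order defect -/

/-- ★★★ **THE EXACT IDENTITY** `E_{l+1}(z, κ) − T_l(E_l)(L•z, κ) = Ũˡ⁺¹[V](z, κ) − 1 − T_l(Ũˡ[V] − 1)(L•z, κ)`, `E_l := (Ũˡ[V] − 1) − Q l Y′`, for ANY `V`, ANY level-`l` field `Y` (meant: `Y = Ũˡ[V] − 1`), ANY `Y′` and ANY family `Q` with the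
recursion text of ✓`Prop7CornerCombStructure.exists_linTower_family` at level `l` (additivity of `T_l`, ✓`trueStep_add`). [cite: Balaban1985Averaging, (68)-(69) p.29, (119)-(122) pp.35-36] -/
theorem rem2_succ_sub_trueStep_eq (L : ℕ) (U₀ V : Site d → Fin d → 𝔸ˣ) (l : ℕ) (Y : Site d → Fin d → 𝔸)
    (Q : ℕ → (Site d → Fin d → 𝔸) → Site d → Fin d → 𝔸) (Y' : Site d → Fin d → 𝔸)
    (hQs : ∀ (z : Site d) (κ : Fin d), Q (l + 1) Y' z κ
      = fderiv ℂ (eml : ((Fin d → Fin L) → 𝔸) → 𝔸) (fun r => ((Wcx L (avgIter L U₀ l) ((L : ℤ) • z) κ (boxVec L r) : 𝔸ˣ) : 𝔸))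
            (fun r => tsum (avgIter L U₀ l) (Q l Y') ((L : ℤ) • z) (gammaWord L κ (boxVec L r) ++ seg κ (-(L : ℤ)))
              * ((Wcx L (avgIter L U₀ l) ((L : ℤ) • z) κ (boxVec L r) : 𝔸ˣ) : 𝔸))
            * (((expUnit (Xavg L (avgIter L U₀ l) ((L : ℤ) • z) κ))⁻¹ : 𝔸ˣ) : 𝔸)
          + ((expUnit (Xavg L (avgIter L U₀ l) ((L : ℤ) • z) κ) : 𝔸ˣ) : 𝔸) * tsum (avgIter L U₀ l) (Q l Y') ((L : ℤ) • z) (seg κ (L : ℤ))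
            * (((expUnit (Xavg L (avgIter L U₀ l) ((L : ℤ) • z) κ))⁻¹ : 𝔸ˣ) : 𝔸))
    (z : Site d) (κ : Fin d) :
    (((tildIter L U₀ V (l + 1) z κ : 𝔸ˣ) : 𝔸) - 1 - Q (l + 1) Y' z κ)
        - (fderiv ℂ (eml : ((Fin d → Fin L) → 𝔸) → 𝔸) (fun r => ((Wcx L (avgIter L U₀ l) ((L : ℤ) • z) κ (boxVec L r) : 𝔸ˣ) : 𝔸))
              (fun r => tsum (avgIter L U₀ l) (Y - Q l Y') ((L : ℤ) • z) (gammaWord L κ (boxVec L r) ++ seg κ (-(L : ℤ)))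
                * ((Wcx L (avgIter L U₀ l) ((L : ℤ) • z) κ (boxVec L r) : 𝔸ˣ) : 𝔸))
              * (((expUnit (Xavg L (avgIter L U₀ l) ((L : ℤ) • z) κ))⁻¹ : 𝔸ˣ) : 𝔸)
            + ((expUnit (Xavg L (avgIter L U₀ l) ((L : ℤ) • z) κ) : 𝔸ˣ) : 𝔸) * tsum (avgIter L U₀ l) (Y - Q l Y') ((L : ℤ) • z) (seg κ (L : ℤ))
              * (((expUnit (Xavg L (avgIter L U₀ l) ((L : ℤ) • z) κ))⁻¹ : 𝔸ˣ) : 𝔸))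
      = ((tildIter L U₀ V (l + 1) z κ : 𝔸ˣ) : 𝔸) - 1
          - (fderiv ℂ (eml : ((Fin d → Fin L) → 𝔸) → 𝔸) (fun r => ((Wcx L (avgIter L U₀ l) ((L : ℤ) • z) κ (boxVec L r) : 𝔸ˣ) : 𝔸))
                (fun r => tsum (avgIter L U₀ l) Y ((L : ℤ) • z) (gammaWord L κ (boxVec L r) ++ seg κ (-(L : ℤ)))
                  * ((Wcx L (avgIter L U₀ l) ((L : ℤ) • z) κ (boxVec L r) : 𝔸ˣ) : 𝔸))
                * (((expUnit (Xavg L (avgIter L U₀ l) ((L : ℤ) • z) κ))⁻¹ : 𝔸ˣ) : 𝔸)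
              + ((expUnit (Xavg L (avgIter L U₀ l) ((L : ℤ) • z) κ) : 𝔸ˣ) : 𝔸) * tsum (avgIter L U₀ l) Y ((L : ℤ) • z) (seg κ (L : ℤ))
                * (((expUnit (Xavg L (avgIter L U₀ l) ((L : ℤ) • z) κ))⁻¹ : 𝔸ˣ) : 𝔸)) := by
  rw [hQs z κ, trueStep_sub]
  abel

section Recursion

variable [Nontrivial 𝔸]

/-- ★★★ **THE SECOND-ORDER DEFECT RECURSION WITH F-2b's SOURCE BOUND**: under F-2b's displayed hypotheses at level `l` (background `Ū₀ˡ = avgIter L U₀ l` unitary-valued with block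
loops within `α ≤ 1∕24` of `1` at the corner `L•z`; `Ũˡ[V]` with values in `U1`; the walk masses of `Y = Ũˡ[V] − 1` along every block loop `Γ_{c,x_r} ∪ (−c)` and along `[c₋, c₊]`
bounded by `m`, `72m ≤ 1`), for ANY `Y′` and ANY family `Q` with the linearised-tower recursion text at level `l`:
`‖E_{l+1}(z, κ) − T_l(E_l)(L•z, κ)‖ ≤ 260·m²`, `E_l := (Ũˡ[V] − 1) − Q l Y′`. [cite: Balaban1985Averaging, (68)-(69) p.29, Prop. 3 (113)-(124) pp.34-36; Balaban1987RG1, (0.4) p.253] -/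
theorem norm_rem2_succ_sub_trueStep_le (L : ℕ) (U₀ V : Site d → Fin d → 𝔸ˣ) (l : ℕ)
    (hV₀ : ∀ x μ, avgIter L U₀ l x μ ∈ unitaryUnits 𝔸) (hV₁ : ∀ x μ, tildIter L U₀ V l x μ ∈ U1 𝔸)
    (Y : Site d → Fin d → 𝔸) (hY : ∀ x μ, Y x μ = ((tildIter L U₀ V l x μ : 𝔸ˣ) : 𝔸) - 1)
    (Q : ℕ → (Site d → Fin d → 𝔸) → Site d → Fin d → 𝔸) (Y' : Site d → Fin d → 𝔸)
    (hQs : ∀ (z : Site d) (κ : Fin d), Q (l + 1) Y' z κ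
      = fderiv ℂ (eml : ((Fin d → Fin L) → 𝔸) → 𝔸) (fun r => ((Wcx L (avgIter L U₀ l) ((L : ℤ) • z) κ (boxVec L r) : 𝔸ˣ) : 𝔸))
            (fun r => tsum (avgIter L U₀ l) (Q l Y') ((L : ℤ) • z) (gammaWord L κ (boxVec L r) ++ seg κ (-(L : ℤ)))
              * ((Wcx L (avgIter L U₀ l) ((L : ℤ) • z) κ (boxVec L r) : 𝔸ˣ) : 𝔸))
            * (((expUnit (Xavg L (avgIter L U₀ l) ((L : ℤ) • z) κ))⁻¹ : 𝔸ˣ) : 𝔸)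
          + ((expUnit (Xavg L (avgIter L U₀ l) ((L : ℤ) • z) κ) : 𝔸ˣ) : 𝔸) * tsum (avgIter L U₀ l) (Q l Y') ((L : ℤ) • z) (seg κ (L : ℤ))
            * (((expUnit (Xavg L (avgIter L U₀ l) ((L : ℤ) • z) κ))⁻¹ : 𝔸ˣ) : 𝔸))
    (z : Site d) (κ : Fin d) {m α : ℝ}
    (hmL : ∀ r : Fin d → Fin L,
      ((List.zip (List.scanl (fun (y : Site d) (l' : Letter d) => y + l'.vec) ((L : ℤ) • z) (gammaWord L κ (boxVec L r) ++ seg κ (-(L : ℤ))))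
          (gammaWord L κ (boxVec L r) ++ seg κ (-(L : ℤ)))).map fun s => ‖stepA Y s.1 s.2‖).sum ≤ m)
    (hmS : ((List.zip (List.scanl (fun (y : Site d) (l' : Letter d) => y + l'.vec) ((L : ℤ) • z) (seg κ (L : ℤ))) (seg κ (L : ℤ))).map
      fun s => ‖stepA Y s.1 s.2‖).sum ≤ m)
    (hm72 : 72 * m ≤ 1)
    (hα : ∀ r : Fin d → Fin L, ‖((Wcx L (avgIter L U₀ l) ((L : ℤ) • z) κ (boxVec L r) : 𝔸ˣ) : 𝔸) - 1‖ ≤ α) (hα24 : α ≤ 1 / 24) :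
    ‖(((tildIter L U₀ V (l + 1) z κ : 𝔸ˣ) : 𝔸) - 1 - Q (l + 1) Y' z κ)
        - (fderiv ℂ (eml : ((Fin d → Fin L) → 𝔸) → 𝔸) (fun r => ((Wcx L (avgIter L U₀ l) ((L : ℤ) • z) κ (boxVec L r) : 𝔸ˣ) : 𝔸))
              (fun r => tsum (avgIter L U₀ l) (Y - Q l Y') ((L : ℤ) • z) (gammaWord L κ (boxVec L r) ++ seg κ (-(L : ℤ)))
                * ((Wcx L (avgIter L U₀ l) ((L : ℤ) • z) κ (boxVec L r) : 𝔸ˣ) : 𝔸))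
              * (((expUnit (Xavg L (avgIter L U₀ l) ((L : ℤ) • z) κ))⁻¹ : 𝔸ˣ) : 𝔸)
            + ((expUnit (Xavg L (avgIter L U₀ l) ((L : ℤ) • z) κ) : 𝔸ˣ) : 𝔸) * tsum (avgIter L U₀ l) (Y - Q l Y') ((L : ℤ) • z) (seg κ (L : ℤ))
              * (((expUnit (Xavg L (avgIter L U₀ l) ((L : ℤ) • z) κ))⁻¹ : 𝔸ˣ) : 𝔸))‖
      ≤ 260 * m ^ 2 := by
  rw [rem2_succ_sub_trueStep_eq L U₀ V l Y Q Y' hQs z κ]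
  exact norm_tildIter_succ_sub_one_sub_trueLin_le L U₀ V l hV₀ hV₁ Y hY z κ hmL hmS hm72 hα hα24

end Recursion

end Summit.QuantumFields.YangMills.Theorems.Prop7CombTildRem2Recursion

end
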